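/-
Copyright (c) 2026 the pub-hodgecm-mathlib formalisation cell (harness21).  Prover seat hodgecm-mathlib-LH7-p05 (g3), Track B «K2-LIT» ∕ hLiu418 #184♮ =
`stmt-HodgeConjecture-24832`, socket #41 KIND 1 a♮ (dec) in the `D`-currency: FILE 1 of the (L3-den) deal (K1a DESK WORD #2 (1), K2Liu-p01 (g11), 2026-09-05T02:08Z)
— «THE MOVING KIND-W PLACE SET IS BOUNDED IN PRODUCT: `∏ q_v` AGAINST HEIGHTS AND DENOMINATORS» (the multiplicative twin of ★ p864221 `K2LiuKindWPlacesCount`).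
THEOREMS ONLY (no `def`, no `instance`, no notation, no named-fact hypothesis, no `sorry`); lane `--supports stmt-HodgeConjecture-24832 --as helper`.
-/
import Summits.HodgeConjecture.HodgeConjecture.Theorems.K2LiuKindWPlacesCount          -- ★ p864221 (C-c): `exists_one_lt_localHeight_of_not_mem_localInt`, `valuation_natCast_lt_one_of_one_lt`, `prod_le_finprod_of_one_le`
import Summits.HodgeConjecture.HodgeConjecture.Theorems.K2LiuIdealPrimeCountLetter     -- ★ p864063: `prod_asIdeal_dvd`
import Mathlib.NumberTheory.RamificationInertia.Inertia                                 -- Mathlib `Ideal.absNorm_eq_pow_inertiaDeg'_of_liesOver` (`q_w = q_v^{f(w∣v)}`)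
import HarnessLib

/-!
# Crux `HLiu418`, socket #41, KIND 1 a♮ ∕ KIND W (dec) — `K2LiuKindWPlacesProduct`: THE MOVING BAD-PLACE SET IN PRODUCT
# `∏_{v ∈ kindWFinset T′ S′ h′ ∖ T′} q_v ≤ (∏ᶠ_w H_w(h′)) · (∏ᶠ_w H_w(w_Δ)) · D^{2[L:ℚ]}`

Cell `hodgecm-mathlib`, crux item hLiu418 = `stmt-HodgeConjecture-24832` (helper lane, count-neutral; closes no socket).  Namespace
`Summit.HodgeConjecture.HodgeConjecture.Cruxes.HLiu418.K2LiuKindWPlacesProduct`.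

WHY.  The (L3-den) finite-head size letter `‖∏_{v∈T S h} Gn S i v s h‖ ≤ C·H(h)^a·(1+τa S)^{N₂}·d^{Nd₂}` (★ p864440's `hGnb` slot) multiplies a PER-PLACE size letter
over the exceptional set `T S h = kindWFinset (T₀ ∪ Tp S) (σc(S)E₁₁) (gc S·h)` (★ p864217 (A) (h1)); per-place factors polynomial in the residue cardinality `q_v` then need
`∏_{v∈T S h} q_v` bounded polynomially in `‖h‖`, `1+τa S`, `d` — the MULTIPLICATIVE twin of the counts ★ p864221 (C-c) ∕ ★ p864275 (C-d-i), which is this file: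
* §1 arithmetic: **`prod_absNorm_le_absNorm`** (`∏_{v∈T} N(v) ≤ N(I)` for distinct primes `v ∣ I` — the step inside ★ p864063 `two_pow_card_le_absNorm`, exported);
  **`prod_absNorm_le_pow_of_natCast`** (`… ≤ D^{[K:ℚ]}` for `I = (D)`); **`residueCard_le_absNorm_placesOver`** (`q_v ≤ N(w)` for `w ∣ v` in the CM extension `L∕L⁺`:
  `N(w) = q_v^{f(w∣v)}`, Mathlib `Ideal.absNorm_eq_pow_inertiaDeg'_of_liesOver`); **`absNorm_le_localHeight_of_one_lt`** (`H_w(g) > 1 ⇒ N(w) ≤ H_w(g)`, as `H_w = N(w)^a`);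
  **`prod_union_le_of_one_le`** (`∏_{s∪t} f ≤ ∏_s f · ∏_t f` for `f ≥ 1`).
* §2 place products: **`prod_residueCard_le_pow_finrank_of_den`** (`∏_{v∈C} q_v ≤ D^{[L:ℚ]}` when every `v ∈ C` carries a non-integral entry of `S` above it and `D·S`
  is `ℤ`-integral); **`prod_residueCard_le_finprod_localHeight`** (`∏_{v∈A} q_v ≤ ∏ᶠ_w H_w(u)` when `u_v ∉ K_v` on `A`);
  head **`prod_residueCard_kindWFinset_sdiff_le`** displayed above (★ (x-a)'s five-set definition of `kindWPlaces`, as in ★ (C-c)).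
References: [BorelJacquet1979, §1.2]; [PlatonovRapinchuk1994, §5.1]; [NeukirchANT1999, Ch. I §3 Thm. (3.3), §6 Prop. (6.1), §8 (primes in extensions: `N(𝔓) = N(𝔭)^f`)];
[KudlaRallis1994, §1]; [Tan1999, §2].
HONEST LABEL: HC_CM is proved only modulo the 7 printed citations (2 remaining named inputs: hLiu418 = stmt-HodgeConjecture-24832, h413 = stmt-HodgeConjecture-24833) until
rung 0 closes; count-neutral helper (`--supports stmt-HodgeConjecture-24832 --as helper`), closes no socket, moves no counter.
-/

set_option autoImplicit false
set_option linter.dupNamespace false -- the mandated namespace repeats `HodgeConjecture.HodgeConjecture`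

noncomputable section

open scoped Matrix NNReal
open NumberField IsDedekindDomain
open Literature.NumberTheory.Automorphic Literature.NumberTheory.GaloisRepresentations
open Literature.NumberTheory.GelbartRogawski1991 Literature.NumberTheory.GelbartRogawski1991.GRConstruction
open Literature.NumberTheory.K2Lit.SiegelDoubled
open Summit.HodgeConjecture.HodgeConjecture.Cruxes.HLiu418.K2LiuSiegelEisensteinKindWLetters
open Summit.HodgeConjecture.HodgeConjecture.Cruxes.HLiu418.K2LiuLocalHeightLevelConjugation (exists_localHeight_eq_pow)
open Summit.HodgeConjecture.HodgeConjecture.Cruxes.HLiu418.K2LiuKindWPlacesCount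
  (exists_one_lt_localHeight_of_not_mem_localInt valuation_natCast_lt_one_of_one_lt prod_le_finprod_of_one_le)
open Summit.HodgeConjecture.HodgeConjecture.Cruxes.HLiu418.K2LiuIdealPrimeCountLetter (prod_asIdeal_dvd)

namespace Summit.HodgeConjecture.HodgeConjecture.Cruxes.HLiu418.K2LiuKindWPlacesProduct

/-! ## §1 Arithmetic tools -/

section Tools

/-- `∏_{s ∪ t} f ≤ (∏_s f) · (∏_t f)` for a real-valued `f ≥ 1` (the overlap `∏_{s ∩ t} f ≥ 1` is dropped). [folklore] -/
theorem prod_union_le_of_one_le {α : Type*} [DecidableEq α] {f : α → ℝ} (hf : ∀ a, 1 ≤ f a) (s t : Finset α) :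
    ∏ a ∈ s ∪ t, f a ≤ (∏ a ∈ s, f a) * ∏ a ∈ t, f a := by
  rw [← Finset.prod_union_inter]
  have h1 : 1 ≤ ∏ a ∈ s ∩ t, f a :=
    calc (1 : ℝ) = ∏ _a ∈ s ∩ t, (1 : ℝ) := Finset.prod_const_one.symm
      _ ≤ ∏ a ∈ s ∩ t, f a := Finset.prod_le_prod (fun _ _ => zero_le_one) fun a _ => hf a
  have h0 : 0 ≤ ∏ a ∈ s ∪ t, f a := Finset.prod_nonneg fun a _ => zero_le_one.trans (hf a)
  calc ∏ a ∈ s ∪ t, f a = (∏ a ∈ s ∪ t, f a) * 1 := (mul_one _).symm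
    _ ≤ (∏ a ∈ s ∪ t, f a) * ∏ a ∈ s ∩ t, f a := mul_le_mul_of_nonneg_left h1 h0

variable {K : Type*} [Field K] [NumberField K]

/-- **`∏_{v∈T} N(v) ≤ N(I)`** for a non-zero integral ideal `I` and a finset `T` of height-one primes each dividing `I` (distinct primes divide jointly, ★ p864063
`prod_asIdeal_dvd`; `N` is multiplicative). [cite: NeukirchANT1999, Ch. I §3 Thm. (3.3); Ch. I §6 Prop. (6.1)] -/
theorem prod_absNorm_le_absNorm {I : Ideal (𝓞 K)} (hI : I ≠ ⊥) (T : Finset (HeightOneSpectrum (𝓞 K))) (hT : ∀ v ∈ T, v.asIdeal ∣ I) :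
    ∏ v ∈ T, Ideal.absNorm v.asIdeal ≤ Ideal.absNorm I := by
  classical
  have hdvd : (∏ v ∈ T, Ideal.absNorm v.asIdeal) ∣ Ideal.absNorm I := by
    rw [← map_prod]
    exact Ideal.absNorm_dvd_absNorm_of_le (Ideal.le_of_dvd (prod_asIdeal_dvd T hT))
  have hI0 : Ideal.absNorm I ≠ 0 := by rwa [Ne, Ideal.absNorm_eq_zero_iff]
  exact Nat.le_of_dvd (Nat.pos_of_ne_zero hI0) hdvd

/-- `∏_{v∈T} N(v) ≤ D^{[K:ℚ]}` for the primes of `K` dividing a natural `D ≠ 0` (`N((D)) = D^{[K:ℚ]}`, Mathlib `Ideal.absNorm_span_natCast`).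
[cite: NeukirchANT1999, Ch. I §6 Prop. (6.1)] -/
theorem prod_absNorm_le_pow_of_natCast {D : ℕ} (hD : D ≠ 0) (T : Finset (HeightOneSpectrum (𝓞 K)))
    (hT : ∀ v ∈ T, v.asIdeal ∣ Ideal.span {(D : 𝓞 K)}) :
    ∏ v ∈ T, Ideal.absNorm v.asIdeal ≤ D ^ Module.finrank ℚ K := by
  have h := prod_absNorm_le_absNorm (I := Ideal.span {(D : 𝓞 K)}) (by
    rw [Ne, Ideal.span_singleton_eq_bot]
    exact_mod_cast hD) T hT
  rwa [Ideal.absNorm_span_natCast, RingOfIntegers.rank] at h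

variable (L : Type) [Field L] [NumberField L]

/-- **`H_w(g) > 1 ⇒ N(w) ≤ H_w(g)`**: the local height is `N(w)^a` (★ `exists_localHeight_eq_pow`) with `a ≥ 1` once it exceeds `1`.
[cite: BorelJacquet1979, §1.2] [cite: MoeglinWaldspurger1995, I.2.2] -/
theorem absNorm_le_localHeight_of_one_lt {N : ℕ} [NeZero N] (w : HeightOneSpectrum (𝓞 L)) (g : GL (Fin N) (AdeleRing (𝓞 L) L))
    (h : 1 < GLn.localHeight N L w g) : ((Ideal.absNorm w.asIdeal : ℕ) : ℝ) ≤ (GLn.localHeight N L w g : ℝ) := by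
  obtain ⟨a, ha⟩ := exists_localHeight_eq_pow L (w := w) g
  have ha0 : a ≠ 0 := by
    rintro rfl
    rw [ha, pow_zero] at h
    exact lt_irrefl _ h
  have h1 : (1 : ℝ) ≤ ((Ideal.absNorm w.asIdeal : ℕ) : ℝ) := by
    exact_mod_cast (one_le_two.trans (Literature.NumberTheory.LFunctions.AbelianDensity.two_le_absNorm L w))
  rw [ha, NNReal.coe_pow, NNReal.coe_natCast]
  calc ((Ideal.absNorm w.asIdeal : ℕ) : ℝ) = ((Ideal.absNorm w.asIdeal : ℕ) : ℝ) ^ 1 := (pow_one _).symm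
    _ ≤ ((Ideal.absNorm w.asIdeal : ℕ) : ℝ) ^ a := pow_le_pow_right₀ h1 (Nat.one_le_iff_ne_zero.2 ha0)

variable [IsCMField L]

omit [IsCMField L] in
/-- **`q_v ≤ N(w)` FOR `w ∣ v` IN THE CM EXTENSION `L ∕ L⁺`**: `N(w) = q_v^{f(w∣v)}` (Mathlib `Ideal.absNorm_eq_pow_inertiaDeg'_of_liesOver`) with `f ≥ 1` (as `N(w) ≥ 2`).
[cite: NeukirchANT1999, Ch. I §8] -/
theorem residueCard_le_absNorm_placesOver (v : HeightOneSpectrum (𝓞 (Fp L))) (w : UnitaryGroup.PlacesOver L v) :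
    v.residueCard ≤ Ideal.absNorm w.1.asIdeal := by
  obtain ⟨w₁, hw₁⟩ := w
  subst hw₁
  haveI : w₁.asIdeal.LiesOver (w₁.under (𝓞 (Fp L))).asIdeal := ⟨rfl⟩
  have hf := Ideal.absNorm_eq_pow_inertiaDeg'_of_liesOver w₁.asIdeal (w₁.under (𝓞 (Fp L))).asIdeal (w₁.under (𝓞 (Fp L))).isPrime
    (w₁.under (𝓞 (Fp L))).ne_bot
  have h2w : 2 ≤ Ideal.absNorm w₁.asIdeal := Literature.NumberTheory.LFunctions.AbelianDensity.two_le_absNorm L w₁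
  have h2v : 2 ≤ Ideal.absNorm (w₁.under (𝓞 (Fp L))).asIdeal := Literature.NumberTheory.LFunctions.AbelianDensity.two_le_absNorm (Fp L) _
  show Ideal.absNorm (w₁.under (𝓞 (Fp L))).asIdeal ≤ Ideal.absNorm w₁.asIdeal
  rw [hf]
  have hf0 : (w₁.under (𝓞 (Fp L))).asIdeal.inertiaDeg' w₁.asIdeal ≠ 0 := by
    intro h0
    rw [h0, pow_zero] at hf
    omega
  calc Ideal.absNorm (w₁.under (𝓞 (Fp L))).asIdeal = Ideal.absNorm (w₁.under (𝓞 (Fp L))).asIdeal ^ 1 := (pow_one _).symm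
    _ ≤ Ideal.absNorm (w₁.under (𝓞 (Fp L))).asIdeal ^ (w₁.under (𝓞 (Fp L))).asIdeal.inertiaDeg' w₁.asIdeal :=
        Nat.pow_le_pow_right (by omega) (Nat.one_le_iff_ne_zero.2 hf0)

end Tools

/-! ## §2 Place products -/

section Products

variable (L : Type) [Field L] [NumberField L] [IsCMField L]

omit [IsCMField L] in
/-- **`∏_{v∈C} q_v ≤ D^{[L:ℚ]}` FOR THE DENOMINATOR PLACES OF A MATRIX**: if `D ≠ 0`, `D·S` is `ℤ`-integral, and every `v ∈ C` (finite places of `L⁺`) has a place `w ∣ v` of `L`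
above which some entry of `S` is NOT integral, then `∏_{v∈C} q_v ≤ D^{[L:ℚ]}` — `v ↦ w(v)` is injective, `q_v ≤ N(w(v))` (`residueCard_le_absNorm_placesOver`), each `w(v) ∣ (D)`
(★ `valuation_natCast_lt_one_of_one_lt`), and `∏ N(w) ≤ N_L((D)) = D^{[L:ℚ]}` (`prod_absNorm_le_pow_of_natCast`). [cite: NeukirchANT1999, Ch. I §3 Thm. (3.3); §6 Prop. (6.1); §8] -/
theorem prod_residueCard_le_pow_finrank_of_den {N : ℕ} (S : Matrix (Fin N) (Fin N) L) {D : ℕ} (hD : D ≠ 0) (hS : ∀ i j, IsIntegral ℤ ((D : L) * S i j))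
    (C : Finset (HeightOneSpectrum (𝓞 (Fp L))))
    (hC : ∀ v ∈ C, ∃ (w : UnitaryGroup.PlacesOver L v) (i j : Fin N), ((S i j : L) : w.1.adicCompletion L) ∉ w.1.adicCompletionIntegers L) :
    ∏ v ∈ C, ((v.residueCard : ℕ) : ℝ) ≤ (D : ℝ) ^ Module.finrank ℚ L := by
  classical
  -- witnesses `w(v) ∣ v` dividing `(D)`
  have hwit : ∀ v ∈ C, ∃ w : UnitaryGroup.PlacesOver L v, w.1.asIdeal ∣ Ideal.span {(D : 𝓞 L)} := by
    intro v hv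
    obtain ⟨w, i, j, hij⟩ := hC v hv
    refine ⟨w, ?_⟩
    have h1 : 1 < w.1.valuation L (S i j) := by
      rw [HeightOneSpectrum.mem_adicCompletionIntegers, HeightOneSpectrum.valuedAdicCompletion_eq_valuation', not_le] at hij
      exact hij
    have hlt := valuation_natCast_lt_one_of_one_lt L w.1 (hS i j) h1
    rw [show ((D : ℕ) : L) = algebraMap (𝓞 L) L (D : 𝓞 L) by rw [map_natCast]] at hlt
    exact (HeightOneSpectrum.valuation_lt_one_iff_dvd w.1 (D : 𝓞 L)).1 hlt
  choose! wv hwv using hwit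
  set f : HeightOneSpectrum (𝓞 (Fp L)) → HeightOneSpectrum (𝓞 L) := fun v => (wv v).1 with hf
  have hinj : Set.InjOn f C := by
    intro v hv v' hv' hvv
    have h1 : (f v).under (𝓞 (Fp L)) = v := (wv v).2
    have h2 : (f v').under (𝓞 (Fp L)) = v' := (wv v').2
    rw [← h1, ← h2, hvv]
  -- `∏_{v∈C} q_v ≤ ∏_{v∈C} N(w(v)) = ∏_{w ∈ w(C)} N(w) ≤ N((D)) = D^{[L:ℚ]}`
  have h1 : ∏ v ∈ C, ((v.residueCard : ℕ) : ℝ) ≤ ∏ v ∈ C, ((Ideal.absNorm (f v).asIdeal : ℕ) : ℝ) :=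
    Finset.prod_le_prod (fun _ _ => Nat.cast_nonneg _) fun v hv => by exact_mod_cast residueCard_le_absNorm_placesOver L v (wv v)
  have h2 : ∏ v ∈ C, ((Ideal.absNorm (f v).asIdeal : ℕ) : ℝ) = ∏ w ∈ C.image f, ((Ideal.absNorm w.asIdeal : ℕ) : ℝ) :=
    (Finset.prod_image (f := fun w : HeightOneSpectrum (𝓞 L) => ((Ideal.absNorm w.asIdeal : ℕ) : ℝ)) hinj).symm
  have h3 : ∏ w ∈ C.image f, Ideal.absNorm w.asIdeal ≤ D ^ Module.finrank ℚ L :=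
    prod_absNorm_le_pow_of_natCast hD (C.image f) fun w hw => by
      obtain ⟨v, hv, rfl⟩ := Finset.mem_image.1 hw
      exact hwv v hv
  calc ∏ v ∈ C, ((v.residueCard : ℕ) : ℝ) ≤ ∏ w ∈ C.image f, ((Ideal.absNorm w.asIdeal : ℕ) : ℝ) := h1.trans_eq h2
    _ ≤ (D : ℝ) ^ Module.finrank ℚ L := by exact_mod_cast h3

variable {N M n : ℕ} (e : Fin N × Fin M ≃ Fin n)
  (dV : Fin N → L) (hdV : ∀ i, IsCMField.complexConj L (dV i) = dV i)
  (dW : Fin M → L) (hdW : ∀ i, IsCMField.complexConj L (dW i) = dW i)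

/-- **`∏_{v∈A} q_v ≤ ∏ᶠ_w H_w(u)` WHEN `u_v ∉ K_v` ON `A`** (`n ≠ 0`): each such `v` has a witness `w(v) ∣ v` with `H_{w(v)}(u) > 1` (★ `exists_one_lt_localHeight_of_not_mem_localInt`),
hence `q_v ≤ N(w(v)) ≤ H_{w(v)}(u)`; `v ↦ w(v)` is injective; the finite sub-product is below the full one (all `H_w ≥ 1`). [cite: BorelJacquet1979, §1.2] [cite: PlatonovRapinchuk1994, §5.1] -/
theorem prod_residueCard_le_finprod_localHeight [NeZero n] (u : HA L e dV hdV dW hdW) (A : Finset (HeightOneSpectrum (𝓞 (Fp L))))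
    (hA : ∀ v ∈ A, UnitaryGroup.evalPlace (Fp L) L (IsCMField.complexConj L) (n + n) (hermD L e dV hdV dW hdW) v
        (UnitaryGroup.finPart (Fp L) L (IsCMField.complexConj L) (n + n) (hermD L e dV hdV dW hdW) u) ∉
      UnitaryGroup.localInt L (IsCMField.complexConj L) (n + n) (hermD L e dV hdV dW hdW) v) :
    ∏ v ∈ A, ((v.residueCard : ℕ) : ℝ) ≤ ∏ᶠ w, (GLn.localHeight (n + n) L w (u : GL (Fin (n + n)) (AdeleRing (𝓞 L) L)) : ℝ) := by
  classical
  haveI : NeZero (n + n) := ⟨by have := NeZero.ne n; omega⟩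
  set g : GL (Fin (n + n)) (AdeleRing (𝓞 L) L) := (u : GL (Fin (n + n)) (AdeleRing (𝓞 L) L)) with hg
  have hwit : ∀ v ∈ A, ∃ w : UnitaryGroup.PlacesOver L v, ((v.residueCard : ℕ) : ℝ) ≤ (GLn.localHeight (n + n) L w.1 g : ℝ) := fun v hv => by
    obtain ⟨w, hw⟩ := exists_one_lt_localHeight_of_not_mem_localInt L e dV hdV dW hdW u v (hA v hv)
    refine ⟨w, ?_⟩
    calc ((v.residueCard : ℕ) : ℝ) ≤ ((Ideal.absNorm w.1.asIdeal : ℕ) : ℝ) := by exact_mod_cast residueCard_le_absNorm_placesOver L v w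
      _ ≤ (GLn.localHeight (n + n) L w.1 g : ℝ) := absNorm_le_localHeight_of_one_lt L w.1 g hw
  choose! wv hwv using hwit
  set f : HeightOneSpectrum (𝓞 (Fp L)) → HeightOneSpectrum (𝓞 L) := fun v => (wv v).1 with hf
  have hinj : Set.InjOn f A := by
    intro v hv v' hv' hvv
    have h1 : (f v).under (𝓞 (Fp L)) = v := (wv v).2
    have h2 : (f v').under (𝓞 (Fp L)) = v' := (wv v').2
    rw [← h1, ← h2, hvv]
  have h1 : ∀ w, (1 : ℝ) ≤ (GLn.localHeight (n + n) L w g : ℝ) := fun w => by exact_mod_cast GLn.one_le_localHeight w g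
  calc ∏ v ∈ A, ((v.residueCard : ℕ) : ℝ) ≤ ∏ v ∈ A, (GLn.localHeight (n + n) L (f v) g : ℝ) :=
        Finset.prod_le_prod (fun _ _ => Nat.cast_nonneg _) fun v hv => hwv v hv
    _ = ∏ w ∈ A.image f, (GLn.localHeight (n + n) L w g : ℝ) :=
        (Finset.prod_image (f := fun w : HeightOneSpectrum (𝓞 L) => (GLn.localHeight (n + n) L w g : ℝ)) hinj).symm
    _ ≤ ∏ᶠ w, (GLn.localHeight (n + n) L w g : ℝ) := prod_le_finprod_of_one_le (GLn.hasFiniteMulSupport_localHeight g) h1 _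

set_option maxHeartbeats 800000 in -- MEASURED class of ★ p864221's head (the same `kindWFinset`∕`HA`∕`weylDelta` telescope on the STATEMENT: 400000 fails, 800000 passes there)
/-- **THE MOVING KIND-W PLACE SET IN PRODUCT.**  For any finset `T′` of finite places of `L⁺`, any index `S′ ∈ M_n(L)`, any point `h′ ∈ H(𝔸)` and any natural `D ≠ 0` with `D·S′`
and `D·S′⁻¹` `ℤ`-integral (for a singular `S′`, `S′⁻¹ = 0`): `∏_{v ∈ kindWFinset T′ S′ h′ ∖ T′} q_v ≤ (∏ᶠ_w H_w(h′)) · (∏ᶠ_w H_w(w_Δ)) · D^{2[L:ℚ]}` — by ★ (x-a)'s definition the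
complement of `T′` is covered by `{h′_v ∉ K_v} ∪ {(w_Δ)_v ∉ K_v} ∪ {S′ non-integral above v} ∪ {S′⁻¹ non-integral above v}`, and the four products are bounded by §2
(`prod_union_le_of_one_le` splits the product since every `q_v ≥ 1`). The multiplicative twin of ★ p864221 `two_pow_card_kindWFinset_sdiff_le`.
[cite: KudlaRallis1994, §1] [cite: Tan1999, §2] [cite: BorelJacquet1979, §1.2] [cite: PlatonovRapinchuk1994, §5.1] [cite: NeukirchANT1999, Ch. I §6 Prop. (6.1); §8] -/
theorem prod_residueCard_kindWFinset_sdiff_le [NeZero n] [DecidableEq (HeightOneSpectrum (𝓞 (Fp L)))]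
    (T' : Finset (HeightOneSpectrum (𝓞 (Fp L)))) (S' : Matrix (Fin n) (Fin n) L) (h' : HA L e dV hdV dW hdW)
    {D : ℕ} (hD : D ≠ 0) (hS : ∀ i j, IsIntegral ℤ ((D : L) * S' i j)) (hSi : ∀ i j, IsIntegral ℤ ((D : L) * S'⁻¹ i j)) :
    ∏ v ∈ kindWFinset L e dV hdV dW hdW T' S' h' \ T', ((v.residueCard : ℕ) : ℝ) ≤
      (∏ᶠ w, (GLn.localHeight (n + n) L w (h' : GL (Fin (n + n)) (AdeleRing (𝓞 L) L)) : ℝ)) *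
        (∏ᶠ w, (GLn.localHeight (n + n) L w (weylDelta L e dV hdV dW hdW : GL (Fin (n + n)) (AdeleRing (𝓞 L) L)) : ℝ)) *
          (D : ℝ) ^ (2 * Module.finrank ℚ L) := by
  classical
  set K := kindWFinset L e dV hdV dW hdW T' S' h' \ T' with hK
  -- the four covering finsets
  set A := K.filter fun v => UnitaryGroup.evalPlace (Fp L) L (IsCMField.complexConj L) (n + n) (hermD L e dV hdV dW hdW) v
        (UnitaryGroup.finPart (Fp L) L (IsCMField.complexConj L) (n + n) (hermD L e dV hdV dW hdW) h') ∉
      UnitaryGroup.localInt L (IsCMField.complexConj L) (n + n) (hermD L e dV hdV dW hdW) v with hAdef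
  set B := K.filter fun v => UnitaryGroup.evalPlace (Fp L) L (IsCMField.complexConj L) (n + n) (hermD L e dV hdV dW hdW) v
        (UnitaryGroup.finPart (Fp L) L (IsCMField.complexConj L) (n + n) (hermD L e dV hdV dW hdW) (weylDelta L e dV hdV dW hdW)) ∉
      UnitaryGroup.localInt L (IsCMField.complexConj L) (n + n) (hermD L e dV hdV dW hdW) v with hBdef
  set C₁ := K.filter fun v => ∃ (w : UnitaryGroup.PlacesOver L v) (i j : Fin n), ((S' i j : L) : w.1.adicCompletion L) ∉ w.1.adicCompletionIntegers L
    with hC₁def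
  set C₂ := K.filter fun v => ∃ (w : UnitaryGroup.PlacesOver L v) (i j : Fin n), ((S'⁻¹ i j : L) : w.1.adicCompletion L) ∉ w.1.adicCompletionIntegers L
    with hC₂def
  -- the cover `K ⊆ A ∪ B ∪ C₁ ∪ C₂` (★ (x-a)'s definition of `kindWPlaces`, off `T′`)
  have hcover : K ⊆ ((A ∪ B) ∪ C₁) ∪ C₂ := by
    intro v hv
    have hvK := hv
    rw [hK, Finset.mem_sdiff, mem_kindWFinset] at hv
    obtain ⟨hmem, hT⟩ := hv
    unfold kindWPlaces at hmem
    rcases hmem with (((h0 | hA) | hB) | hC) | hC'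
    · exact absurd (Finset.mem_coe.1 h0) hT
    · exact Finset.mem_union_left _ (Finset.mem_union_left _ (Finset.mem_union_left _ (Finset.mem_filter.2 ⟨hvK, hA⟩)))
    · exact Finset.mem_union_left _ (Finset.mem_union_left _ (Finset.mem_union_right _ (Finset.mem_filter.2 ⟨hvK, hB⟩)))
    · exact Finset.mem_union_left _ (Finset.mem_union_right _ (Finset.mem_filter.2 ⟨hvK, hC⟩))
    · exact Finset.mem_union_right _ (Finset.mem_filter.2 ⟨hvK, hC'⟩)
  -- every factor `q_v ≥ 1`
  have hq1 : ∀ v : HeightOneSpectrum (𝓞 (Fp L)), (1 : ℝ) ≤ ((v.residueCard : ℕ) : ℝ) := fun v => by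
    exact_mod_cast v.one_lt_residueCard.le
  -- the four products
  have hA : ∏ v ∈ A, ((v.residueCard : ℕ) : ℝ) ≤ ∏ᶠ w, (GLn.localHeight (n + n) L w (h' : GL (Fin (n + n)) (AdeleRing (𝓞 L) L)) : ℝ) :=
    prod_residueCard_le_finprod_localHeight L e dV hdV dW hdW h' A fun v hv => (Finset.mem_filter.1 hv).2
  have hB : ∏ v ∈ B, ((v.residueCard : ℕ) : ℝ) ≤ ∏ᶠ w, (GLn.localHeight (n + n) L w (weylDelta L e dV hdV dW hdW : GL (Fin (n + n)) (AdeleRing (𝓞 L) L)) : ℝ) :=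
    prod_residueCard_le_finprod_localHeight L e dV hdV dW hdW (weylDelta L e dV hdV dW hdW) B fun v hv => (Finset.mem_filter.1 hv).2
  have hC₁ : ∏ v ∈ C₁, ((v.residueCard : ℕ) : ℝ) ≤ (D : ℝ) ^ Module.finrank ℚ L :=
    prod_residueCard_le_pow_finrank_of_den L S' hD hS C₁ fun v hv => (Finset.mem_filter.1 hv).2
  have hC₂ : ∏ v ∈ C₂, ((v.residueCard : ℕ) : ℝ) ≤ (D : ℝ) ^ Module.finrank ℚ L :=
    prod_residueCard_le_pow_finrank_of_den L S'⁻¹ hD hSi C₂ fun v hv => (Finset.mem_filter.1 hv).2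
  have hP1 : 0 ≤ ∏ᶠ w, (GLn.localHeight (n + n) L w (h' : GL (Fin (n + n)) (AdeleRing (𝓞 L) L)) : ℝ) := finprod_nonneg fun _ => NNReal.coe_nonneg _
  have hP2 : 0 ≤ ∏ᶠ w, (GLn.localHeight (n + n) L w (weylDelta L e dV hdV dW hdW : GL (Fin (n + n)) (AdeleRing (𝓞 L) L)) : ℝ) :=
    finprod_nonneg fun _ => NNReal.coe_nonneg _
  have hD0 : (0 : ℝ) ≤ (D : ℝ) ^ Module.finrank ℚ L := by positivity
  have h0A : 0 ≤ ∏ v ∈ A, ((v.residueCard : ℕ) : ℝ) := Finset.prod_nonneg fun _ _ => Nat.cast_nonneg _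
  have h0B : 0 ≤ ∏ v ∈ B, ((v.residueCard : ℕ) : ℝ) := Finset.prod_nonneg fun _ _ => Nat.cast_nonneg _
  have h0C₁ : 0 ≤ ∏ v ∈ C₁, ((v.residueCard : ℕ) : ℝ) := Finset.prod_nonneg fun _ _ => Nat.cast_nonneg _
  calc ∏ v ∈ K, ((v.residueCard : ℕ) : ℝ)
      ≤ ∏ v ∈ ((A ∪ B) ∪ C₁) ∪ C₂, ((v.residueCard : ℕ) : ℝ) :=
        Finset.prod_le_prod_of_subset_of_one_le hcover (fun v _ => zero_le_one.trans (hq1 v)) fun v _ _ => hq1 v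
    _ ≤ (∏ v ∈ (A ∪ B) ∪ C₁, ((v.residueCard : ℕ) : ℝ)) * ∏ v ∈ C₂, ((v.residueCard : ℕ) : ℝ) := prod_union_le_of_one_le hq1 _ _
    _ ≤ ((∏ v ∈ A ∪ B, ((v.residueCard : ℕ) : ℝ)) * ∏ v ∈ C₁, ((v.residueCard : ℕ) : ℝ)) * ∏ v ∈ C₂, ((v.residueCard : ℕ) : ℝ) :=
        mul_le_mul_of_nonneg_right (prod_union_le_of_one_le hq1 _ _) (Finset.prod_nonneg fun _ _ => Nat.cast_nonneg _)
    _ ≤ (((∏ v ∈ A, ((v.residueCard : ℕ) : ℝ)) * ∏ v ∈ B, ((v.residueCard : ℕ) : ℝ)) * ∏ v ∈ C₁, ((v.residueCard : ℕ) : ℝ)) *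
          ∏ v ∈ C₂, ((v.residueCard : ℕ) : ℝ) :=
        mul_le_mul_of_nonneg_right (mul_le_mul_of_nonneg_right (prod_union_le_of_one_le hq1 _ _) h0C₁)
          (Finset.prod_nonneg fun _ _ => Nat.cast_nonneg _)
    _ ≤ (((∏ᶠ w, (GLn.localHeight (n + n) L w (h' : GL (Fin (n + n)) (AdeleRing (𝓞 L) L)) : ℝ)) *
          (∏ᶠ w, (GLn.localHeight (n + n) L w (weylDelta L e dV hdV dW hdW : GL (Fin (n + n)) (AdeleRing (𝓞 L) L)) : ℝ))) *
          (D : ℝ) ^ Module.finrank ℚ L) * (D : ℝ) ^ Module.finrank ℚ L := by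
        gcongr
    _ = _ := by rw [two_mul, pow_add]; ring

end Products

end Summit.HodgeConjecture.HodgeConjecture.Cruxes.HLiu418.K2LiuKindWPlacesProduct

end
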